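import Literature.Computability.Complexity.FKPointLocationUntyped
import Literature.Computability.Complexity.FKPointLocationProtocolValid
import HarnessLib

/-!
# Fournier–Koiran point location, XV: the located rational point as an integer recursion

Topic `Literature/Computability/Complexity`, grouping namespace `FKPointLocation`. The rational
point `x* = xStar 0 = xStarRev J` of the located face (`FKPointLocationCertificates.lean`:
`x*^{(J)} = s_J`, `x*^{(j)} = s_j + μ_j (x*^{(j+1)} - s_j)`, `μ_0 = 1`, `μ_j = ρ_j/16`) is computed from
the level records of a state (most recent level first) by one pass of INTEGER arithmetic on
homogeneous coordinates `(N, R)` (`xsStep`, `xsGo`: `N' = σ R m_D + m_N (N d - σ R)`,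
`R' = d R m_D` with `μ = m_N/m_D`), and `N/R = xStarRev (certOf dat) J` (`xsGo_eq_xStarRev`). The
untyped mirror `uxsGo` on lists commutes with it (`toU_xsGo`). This is the point "`q ∈ P_S` with
small coordinates" at which the final `NP` query of Theorem 3 runs the real machine (report p. 11),
made explicit.

## References

* H. Fournier, P. Koiran, *Lower bounds are not easier over the reals: inside PH*, ICALP 2000,
  LNCS 1853 = LIP RR-1999-21, p. 11 (proof of Thm 3). [FournierKoiran2000]
-/

namespace Literature.Computability.Complexity

namespace FKPointLocation

open Classical

variable (Q : LevelParams)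

/-! ### The integer recursion -/

/-- The un-projection ratio of a level as a fraction `m_N / m_D`: `1/1` at level `0`, else
`2^{κ(sc+1)} / 2^{L+5} = ρ_j / 16`; the scale is clamped to a budget `U` (harmless on genuine runs,
where `sc ≤ D ≤ U`; it keeps the exponent polynomial on every input). [folklore] -/
def muN (U : ℕ) (isZero : Bool) (sc : ℕ) : ℤ := if isZero then 1 else 2 ^ (Q.κ * (min sc U + 1))

/-- Denominator of the ratio. [folklore] -/
def muD (isZero : Bool) : ℕ := if isZero then 1 else 2 ^ (Q.L + 5)

/-- One un-projection step in homogeneous integer coordinates. [cite: FournierKoiran2000, p. 11] -/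
def xsStep (U : ℕ) (isZero : Bool) (r : LevelRec Q.D) (p : (Fin Q.D → ℤ) × ℕ) : (Fin Q.D → ℤ) × ℕ :=
  (fun k => r.apex.1 k * p.2 * (muD Q isZero : ℤ) + muN Q U isZero r.sc * (p.1 k * r.apex.2 - r.apex.1 k * p.2),
    r.apex.2 * p.2 * muD Q isZero)

/-- The pass over the remaining (older) levels; the last record is level `0`. [folklore] -/
def xsGo (U : ℕ) : List (LevelRec Q.D) → (Fin Q.D → ℤ) × ℕ → (Fin Q.D → ℤ) × ℕ
  | [], p => p
  | r :: rest, p => xsGo U rest (xsStep Q U rest.isEmpty r p)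

/-- **The located point in homogeneous integer coordinates** from the level records (most recent
first): start at the apex of the deepest level. [cite: FournierKoiran2000, p. 11] -/
def xsOf (U : ℕ) (levels : List (LevelRec Q.D)) : (Fin Q.D → ℤ) × ℕ :=
  match levels with
  | [] => (0, 1)
  | r :: rest => xsGo Q U rest (r.apex.1, r.apex.2)

/-! ### Correctness against `xStarRev` -/

variable {Q}

/-- The rational point of homogeneous coordinates. [folklore] -/
def ratPt (p : (Fin Q.D → ℤ) × ℕ) : Fin Q.D → ℚ := fun k => (p.1 k : ℚ) / p.2

/-- The step is the rational un-projection `s + μ (x - s)`. [folklore] -/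
theorem ratPt_xsStep (U : ℕ) (isZero : Bool) (r : LevelRec Q.D) (p : (Fin Q.D → ℤ) × ℕ) (hp : 0 < p.2) (hr : 0 < r.apex.2) :
    ratPt (xsStep Q U isZero r p) =
      (fun k => (r.apex.1 k : ℚ) / r.apex.2) +
        ((muN Q U isZero r.sc : ℚ) / muD Q isZero) • (ratPt p - fun k => (r.apex.1 k : ℚ) / r.apex.2) := by
  have hD : (0 : ℚ) < muD Q isZero := by unfold muD; split_ifs <;> positivity
  funext k
  simp only [ratPt, xsStep, Pi.add_apply, Pi.smul_apply, Pi.sub_apply, smul_eq_mul]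
  push_cast
  field_simp

/-- Denominators stay positive. [folklore] -/
theorem xsStep_snd_pos (U : ℕ) (isZero : Bool) (r : LevelRec Q.D) (p : (Fin Q.D → ℤ) × ℕ) (hp : 0 < p.2) (hr : 0 < r.apex.2) :
    0 < (xsStep Q U isZero r p).2 := by
  unfold xsStep muD; split_ifs <;> simp only <;> positivity

/-- `μ_j` of the certificate of a state is `muN/muD` of the record of level `j` (scale within the budget). [folklore] -/
theorem μ_certOf (dat : Data Q.D) (j : ℕ) {U : ℕ} (hU : (Data.recAt Q dat j).sc ≤ U) :
    (certOf Q dat).μ j = (muN Q U (decide (j = 0)) (Data.recAt Q dat j).sc : ℚ) / muD Q (decide (j = 0)) := by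
  unfold Cert.μ muN muD
  rw [min_eq_left hU]
  by_cases hj : j = 0
  · simp [hj]
  · simp only [hj, if_false, decide_false, Bool.false_eq_true]
    show Q.ρ ((Data.recAt Q dat j).sc + 1) / 16 = _
    unfold LevelParams.ρ
    push_cast
    rw [pow_add _ (Q.L + 1) 4]
    norm_num
    ring

/-- **The integer pass computes `xStarRev`**: processing the first `k` older records of a state with
`J + 1` levels yields `x*` at level `J - k`. [cite: FournierKoiran2000, p. 11] -/
theorem xsGo_spec (dat : Data Q.D) (hpos : ∀ r ∈ dat.levels, 0 < r.apex.2) {U : ℕ} (hU : ∀ r ∈ dat.levels, r.sc ≤ U)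
    (r₀ : LevelRec Q.D) (rest : List (LevelRec Q.D)) (hl : dat.levels = r₀ :: rest) :
    ∀ (k : ℕ) (done todo : List (LevelRec Q.D)), rest = done ++ todo → done.length = k →
      ∀ p : (Fin Q.D → ℤ) × ℕ, 0 < p.2 → ratPt p = (certOf Q dat).xStarRev k →
        0 < (xsGo Q U todo p).2 ∧ ratPt (xsGo Q U todo p) = (certOf Q dat).xStarRev (k + todo.length) := by
  intro k done todo
  induction todo generalizing k done with
  | nil => intro _ _ p hp hrat; simpa [xsGo] using And.intro hp hrat
  | cons r todo ih =>
    intro hsplit hlen p hp hrat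
    simp only [xsGo]
    have hJ : (certOf Q dat).J = rest.length := by simp [certOf, hl]
    have hklt : k + 1 < dat.levels.length := by rw [hl, hsplit]; simp [hlen]
    have hrec : Data.recAt Q dat (rest.length - (k + 1)) = r := by
      have h1 : dat.levels.length - 1 - (k + 1) = rest.length - (k + 1) := by rw [hl]; simp
      rw [← h1, recAt_eq_getElem dat hklt]
      simp [hl, hsplit, hlen]
    have hr : 0 < r.apex.2 := hpos r (by rw [hl, hsplit]; simp)
    have hzero : todo.isEmpty = decide (rest.length - (k + 1) = 0) := by
      rw [hsplit]; cases todo <;> simp [hlen]; omega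
    have hrU : r.sc ≤ U := hU r (by rw [hl, hsplit]; simp)
    have hs : (certOf Q dat).s (rest.length - (k + 1)) = fun i => (r.apex.1 i : ℚ) / r.apex.2 := by
      simp only [certOf, hrec]
    have hstep : ratPt (xsStep Q U todo.isEmpty r p) = (certOf Q dat).xStarRev (k + 1) := by
      rw [ratPt_xsStep _ _ _ _ hp hr, Cert.xStarRev, hJ, μ_certOf dat _ (U := U) (by rw [hrec]; exact hrU), hrec, hzero, hrat, hs]
    have := ih (k + 1) (done ++ [r]) (by rw [hsplit]; simp) (by simp [hlen]) _ (xsStep_snd_pos _ _ _ _ hp hr) hstep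
    simpa [Nat.add_assoc, Nat.add_comm 1] using this

/-- **`xsOf` is the located point**: for a state whose apex denominators are positive,
`ratPt (xsOf levels) = xStar 0` and the denominator is positive. [cite: FournierKoiran2000, p. 11] -/
theorem ratPt_xsOf (dat : Data Q.D) (hpos : ∀ r ∈ dat.levels, 0 < r.apex.2) {U : ℕ} (hU : ∀ r ∈ dat.levels, r.sc ≤ U)
    (hne : dat.levels ≠ []) :
    0 < (xsOf Q U dat.levels).2 ∧ ratPt (xsOf Q U dat.levels) = (certOf Q dat).xStar 0 := by
  obtain ⟨r₀, rest, hl⟩ := List.exists_cons_of_ne_nil hne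
  have hJ : (certOf Q dat).J = rest.length := by simp [certOf, hl]
  have h0 : ratPt ((r₀.apex.1, r₀.apex.2) : (Fin Q.D → ℤ) × ℕ) = (certOf Q dat).xStarRev 0 := by
    rw [Cert.xStarRev]
    have hrec : Data.recAt Q dat (dat.levels.length - 1) = r₀ := by
      have h1 : dat.levels.length - 1 - 0 = dat.levels.length - 1 := by simp
      rw [← h1, recAt_eq_getElem dat (by rw [hl]; simp)]
      simp [hl]
    funext k
    simp only [ratPt, certOf, hrec]
  have := xsGo_spec dat hpos hU r₀ rest hl 0 [] rest rfl rfl (r₀.apex.1, r₀.apex.2) (hpos r₀ (by rw [hl]; simp)) h0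
  rw [hl]
  simp only [xsOf, Cert.xStar, hJ, Nat.sub_zero]
  simpa using this

/-! ### The untyped mirror -/

/-- `xsStep`, untyped. [folklore] -/
def uxsStep (P : UParams) (U : ℕ) (isZero : Bool) (r : ULevelRec) (p : List ℤ × ℕ) : List ℤ × ℕ :=
  let mN : ℤ := if isZero then 1 else 2 ^ (P.κ * (min r.sc U + 1))
  let mD : ℕ := if isZero then 1 else 2 ^ (P.L + 5)
  (List.zipWith (fun σk Nk => σk * p.2 * (mD : ℤ) + mN * (Nk * r.apexD - σk * p.2)) r.apexN p.1, r.apexD * p.2 * mD)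

/-- `xsGo`, untyped (a left fold with the "last item" flag read off the remaining length). [folklore] -/
def uxsGo (P : UParams) (U : ℕ) : List ULevelRec → List ℤ × ℕ → List ℤ × ℕ
  | [], p => p
  | r :: rest, p => uxsGo P U rest (uxsStep P U rest.isEmpty r p)

/-- `xsOf`, untyped. [folklore] -/
def uxsOf (P : UParams) (U : ℕ) (levels : List ULevelRec) : List ℤ × ℕ :=
  match levels with
  | [] => (List.replicate P.D 0, 1)
  | r :: rest => uxsGo P U rest (r.apexN, r.apexD)

/-- `xsStep` commutes. [folklore] -/
theorem toU_xsStep (U : ℕ) (isZero : Bool) (r : LevelRec Q.D) (p : (Fin Q.D → ℤ) × ℕ) :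
    (List.ofFn (xsStep Q U isZero r p).1, (xsStep Q U isZero r p).2) = uxsStep Q.toU U isZero r.toU (List.ofFn p.1, p.2) := by
  simp only [xsStep, uxsStep, LevelRec.toU, muN, muD, zipWith_ofFn, show Q.toU.L = Q.L from rfl, show Q.toU.κ = Q.κ from rfl]

/-- `xsGo` commutes. [folklore] -/
theorem toU_xsGo (U : ℕ) : ∀ (l : List (LevelRec Q.D)) (p : (Fin Q.D → ℤ) × ℕ),
    (List.ofFn (xsGo Q U l p).1, (xsGo Q U l p).2) = uxsGo Q.toU U (l.map LevelRec.toU) (List.ofFn p.1, p.2)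
  | [], p => rfl
  | r :: rest, p => by
    simp only [xsGo, List.map_cons, uxsGo]
    rw [toU_xsGo U rest, toU_xsStep]
    cases rest <;> rfl

/-- **`xsOf` commutes with forgetting the dimension.** [folklore] -/
theorem toU_xsOf (U : ℕ) (dat : Data Q.D) :
    (List.ofFn (xsOf Q U dat.levels).1, (xsOf Q U dat.levels).2) = uxsOf Q.toU U dat.toU.levels := by
  have : dat.toU.levels = dat.levels.map LevelRec.toU := rfl
  rw [this]
  rcases hl : dat.levels with _ | ⟨r, rest⟩
  · simp only [xsOf, uxsOf, List.map_nil]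
    rw [ofFn_zero]; rfl
  · simp only [xsOf, uxsOf, List.map_cons]
    rw [toU_xsGo]; rfl

/-- `uxsGo` as a left fold over the items paired with the "last" flag. [folklore] -/
theorem uxsGo_eq_foldl (P : UParams) (U : ℕ) : ∀ (l : List ULevelRec) (p : List ℤ × ℕ),
    uxsGo P U l p = ((List.range l.length).zip l).foldl (fun q t => uxsStep P U (decide (t.1 + 1 = l.length)) t.2 q) p
  | [], p => rfl
  | r :: rest, p => by
    rw [uxsGo, uxsGo_eq_foldl P U rest]
    rw [List.length_cons, List.range_succ_eq_map, List.zip_cons_cons, List.foldl_cons]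
    have hflag : decide (0 + 1 = rest.length + 1) = rest.isEmpty := by cases rest <;> simp
    rw [hflag]
    -- re-index the remaining items
    have key : ∀ (q : List ℤ × ℕ),
        ((List.range rest.length).map Nat.succ |>.zip rest).foldl (fun q t => uxsStep P U (decide (t.1 + 1 = rest.length + 1)) t.2 q) q =
          ((List.range rest.length).zip rest).foldl (fun q t => uxsStep P U (decide (t.1 + 1 = rest.length)) t.2 q) q := by
      intro q
      rw [show ((List.range rest.length).map Nat.succ).zip rest = ((List.range rest.length).zip rest).map (fun t => (t.1 + 1, t.2)) by
        rw [List.zip_map_left]; rfl]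
      rw [List.foldl_map]
      simp only [Nat.succ_inj]
    exact (key _).symm

end FKPointLocation

end Literature.Computability.Complexity
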